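import Literature.MathematicalPhysics.QuantumFieldTheory.Balaban1983to89.B8Ineq159FlatCubeMemberKernel
import Literature.MathematicalPhysics.QuantumFieldTheory.Balaban1983to89.B9Eq316TowerFlatIsOneStep

/-!
# `Balaban1983to89.B8Ineq159FlatCubeMemberPerCube` — [Balaban1985RegularSpaces] (1.59) AT `U₀ = 1` ON THE CUBE MEMBER `{□_j}` OF (1.131) WITH THE
# AVERAGING DATUM OVER PRINT'S CLASS `cubeLamBP`: AT EVERY FIXED MEMBER (`k ≥ 1`), TRUNCATION `1 ≤ m ≤ k` AND `η > 0` THE BODY OF dag-n05-c's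
# REPAIRED TARGET `B8Ineq159FlatCubeMemberPrinted.Ineq159FlatCubeMemberPrinted` HOLDS WITH SOME `B₀ > 0` (depending on the member) — the A6
# inhabitant of the repaired flat road at non-degenerate data; print's UNIFORM `B₀(d, L)` ([4] Thm 3.3) is NOT claimed

statement-level skeleton of published theorems with citation tags; proofs where landed; nothing here is a claim about the
Yang–Mills mass gap

`[Balaban1985RegularSpaces]` ("B8", CMP **99** (1985) 75–102) (1.58)–(1.59) p. 86, (1.62) p. 87, (1.31) p. 82, (1.38) p. 82, (1.55) p. 86, (1.131) p. 99;
`[Balaban1984PropagatorsII]` ("B6", CMP **96** (1984) 223–250) (2.3) p. 224, (2.11) p. 225 («Δ is positive on N(Q′), hence it is invertible on this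
subspace»); `[Balaban1985BackgroundPropagators]` ("[4]", CMP **99** (1985) 389–434) (3.4) p. 391, (3.15) p. 393, (3.19) p. 393, (3.23)–(3.25) p. 394,
Thm 3.3 p. 399; `[Balaban1985Averaging]` ("B7") (122) + (125) p. 36, (127) p. 37.

CITATION HEADER (lean-in-tree rule).  Cell `pub-ymgap` (YM Track A, HUMAN RULING D-0062 ∕ D-0149), DAG node N05 = [B8], width seat
`pub-ymgap-dag-n05-w3` (g0), CLAIM-2 ∕ INTENT-3 (bus 2026-08-27; dag-lead DEDUP-354 GO for the CLAIM).  WHY.  The kernel certificate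
`B8Ineq159FlatCubeMemberKernel.eq_zero_of_ineq159FlatData_eq_zero` (this seat, p583885) says that the hypotheses of the repaired flat (1.59) target with
`N = 0` force `φ = 0`.  THIS FILE turns that into the INHABITANT the A6 rule (director-ym №189 ∕ FLAG №4) asks of the repaired road: at every
cube member with `k ≥ 1`, every `1 ≤ m ≤ k`, the three conclusions of `Ineq159FlatCubeMemberPrinted`'s body hold for every admissible `φ` and `N`
with a finite constant `B₀` — so the repaired hypotheses (flat Landau gauge of record ∕ (1.55) datum ∕ averaging datum over `cubeLamBP` ∕ exterior
datum) are JOINTLY SATISFIABLE and NON-DEGENERATE at every member (contrast: over the typed class `cubeLamB` they are refuted for every `B₀`,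
`B8Ineq159FlatShellModeVacuity` p572834).  The argument is finite-dimensional linear algebra; no estimate of Bałaban is used or asserted.

THE MATHEMATICS (kernel-checked).
* §1 ★ `exists_bound_of_forall_eq_zero` — LINEAR ALGEBRA: on a `ℂ`-submodule `V`, finitely many linear functionals `f_a` with trivial joint kernel
  dominate every finite family `g_b`: `‖g_b v‖ ≤ C·N` whenever all `‖f_a v‖ ≤ N` (`v ∈ V`), ONE `C ≥ 0` (left inverse of `v ↦ (f_a v)_a` on `V`,
  `LinearMap.exists_leftInverse_of_injective`; coordinate expansion in `A → ℂ`).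
* §2 FLAT LINEARITY (explicit stencils): `linQ`∕`linQIter` (B7 (122), (127) at `U₀ = 1`), `iEta`, `plaqCovDeriv`, `Jcur` (1.55), `covDivB`,
  `covLap`, the flat `Q′(1)ᵀ` (`QT`) are additive and `ℂ`-homogeneous; ★ `isLandau138_flat_add` ∕ `isLandau138_flat_smul` — the flat Landau gauge of
  record (1.38) (multiplier form) is a `ℂ`-SUBSPACE (add ∕ scale the multipliers).
* §3 FINITENESS: the bonds touching `□₀` (`bondTouches_cube_zero_finite`), the graded bonds of print's class (`cubeLamBP_pairs_finite`) and the graded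
  side-touching bonds (`sideTouches_pairs_finite`) of one member are finite sets.
* §4 ★★★ `exists_B0_ineq159Flat_perCube` — assembly: `V` = {Landau of record ∧ support clause} (§2); data functionals = `η³·J_τ(y)` on the bonds
  of `□₀`, `linQIter L (iηφ) j c` on the graded class (= `linCovIter L 1 (iηφ) j c` on the bounded fields of `V`,
  `B9Eq316TowerFlatIsOneStep.linCovIter_one_left`), `η·φ_τ(y)` on the side-touching bonds off `□₀`; targets = the three weighted quantities of (1.62);
  joint kernel trivial by the kernel certificate; §1 gives `C`; `B₀ := max C 1`.

HONEST SCOPE.  A satisfiability ∕ non-degeneracy witness (finite-dimensional); the constant depends on the member and is NOT print's `B₀(d, L)`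
— `Ineq159FlatCubeMemberPrinted` (uniform constant, thresholds on print's p. 98 sub-lattice) stays OPEN (transplant T2–T4, dag-n05-c lineage);
nothing of Bałaban's analysis asserted; count-neutral; N05 NOT discharged; no count claim; one finite `T⁴` programme at fixed `ε`, Bałaban as
printed; the YM mass gap (Clay) is NOT proved by any of this — R4 closes the conditional finite-`𝕋⁴` rung `BalabanLadder.UV` only; nothing continuum ∕
ℝ⁴ ∕ OS.  No `sorry`, no `def`, no `instance`, no `notation`.  Unit `pub-ymgap-dag-n05-w3` (g0), 2026-08-27.
-/

noncomputable section

open ComplexConjugate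

namespace Literature.MathematicalPhysics.QuantumFieldTheory.Balaban1983to89.B8Ineq159FlatCubeMemberPerCube

/-! ## §1 Linear algebra: finitely many functionals with trivial joint kernel dominate any finite family -/

/-- ★ **DOMINATION BY DATA WITH TRIVIAL JOINT KERNEL** (pure linear algebra, the finite-dimensional mechanism behind «Δ is positive on N(Q′), hence
invertible» ⇒ bounds): on a submodule `V`, if finitely many `ℂ`-linear functionals `f_a` vanish simultaneously only at `0`, then every finite family of
linear functionals `g_b` is dominated: `‖g_b v‖ ≤ C·N` whenever `‖f_a v‖ ≤ N` for all `a` (`v ∈ V`), for ONE constant `C ≥ 0` — via a linear left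
inverse of `v ↦ (f_a v)_a` on `V` (`LinearMap.exists_leftInverse_of_injective`) and the coordinate expansion in `A → ℂ`.
[cite: Balaban1984PropagatorsII, (2.11) p.225] -/
theorem exists_bound_of_forall_eq_zero {E : Type*} [AddCommGroup E] [Module ℂ E] (V : Submodule ℂ E)
    {A B : Type*} [Fintype A] [Fintype B] (f : A → E →ₗ[ℂ] ℂ) (g : B → E →ₗ[ℂ] ℂ)
    (hinj : ∀ v ∈ V, (∀ a, f a v = 0) → v = 0) :
    ∃ C : ℝ, 0 ≤ C ∧ ∀ v ∈ V, ∀ N : ℝ, 0 ≤ N → (∀ a, ‖f a v‖ ≤ N) → ∀ b, ‖g b v‖ ≤ C * N := by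
  classical
  -- the data map on `V` and its linear left inverse
  let F : V →ₗ[ℂ] (A → ℂ) := LinearMap.pi fun a => (f a).domRestrict V
  have hF : ∀ (v : V) (a : A), F v a = f a v := fun v a => rfl
  have hker : LinearMap.ker F = ⊥ := by
    rw [LinearMap.ker_eq_bot']
    intro v hv
    have h0 : ∀ a, f a v = 0 := fun a => by rw [← hF v a, hv]; rfl
    exact Subtype.ext (hinj v v.2 h0)
  obtain ⟨G, hG⟩ := LinearMap.exists_leftInverse_of_injective F hker
  have hGF : ∀ v : V, G (F v) = v := fun v => by
    have := LinearMap.congr_fun hG v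
    simpa using this
  -- the composite functionals on `A → ℂ` and the constant
  let h : B → (A → ℂ) →ₗ[ℂ] ℂ := fun b => ((g b).domRestrict V) ∘ₗ G
  refine ⟨∑ b, ∑ a, ‖h b (Pi.single a 1)‖, by positivity, fun v hv N hN hf b => ?_⟩
  have hdec : F ⟨v, hv⟩ = ∑ a, (f a v) • (Pi.single a (1 : ℂ) : A → ℂ) := by
    ext a'
    rw [hF, Finset.sum_apply, Finset.sum_eq_single a']
    · simp
    · intro a _ ha; simp [Ne.symm ha]
    · intro ha; exact absurd (Finset.mem_univ a') ha
  have hgv : g b v = h b (F ⟨v, hv⟩) := by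
    show g b v = (g b).domRestrict V (G (F ⟨v, hv⟩))
    rw [hGF]; rfl
  rw [hgv, hdec, map_sum]
  calc ‖∑ a, h b ((f a v) • (Pi.single a (1 : ℂ) : A → ℂ))‖
      ≤ ∑ a, ‖h b ((f a v) • (Pi.single a (1 : ℂ) : A → ℂ))‖ := norm_sum_le _ _
    _ = ∑ a, ‖f a v‖ * ‖h b (Pi.single a 1)‖ := by
        refine Finset.sum_congr rfl fun a _ => ?_
        rw [map_smul, norm_smul]
    _ ≤ ∑ a, N * ‖h b (Pi.single a 1)‖ :=
        Finset.sum_le_sum fun a _ => mul_le_mul_of_nonneg_right (hf a) (norm_nonneg _)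
    _ = (∑ a, ‖h b (Pi.single a 1)‖) * N := by rw [← Finset.mul_sum, mul_comm]
    _ ≤ (∑ b, ∑ a, ‖h b (Pi.single a 1)‖) * N :=
        mul_le_mul_of_nonneg_right (Finset.single_le_sum (f := fun b => ∑ a, ‖h b (Pi.single a 1)‖)
          (fun _ _ => Finset.sum_nonneg fun _ _ => norm_nonneg _) (Finset.mem_univ b)) hN


variable {d : ℕ}

open B7Prop1Explicit B7Prop2Explicit B7Prop1Local
open B7Prop4GeneralLevels (linCovIter)
open B7Prop3Flat (linQ)
open B7Prop4Flat (linQIter linQIter_zero linQIter_succ linQ_sub norm_linQIter_le)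
open B9Eq316TowerFlatIsOneStep (linCovIter_one_left)
open B8Ineq132 (covDerivFwd covDeriv BondTouches PlaqTouches)
open B8Eq140Level (SideTouches IsSide)
open B8Eq143PlaqExpansion (pdiv pdiv_add)
open B8Eq146AExpansion (iEta plaqCovDeriv plaqCovDeriv_eq_covDerivFwd pdiv_smul)
open B8Eq155JBound (Jcur)
open B8Eq138LandauZd (IsLandau138 covLap covDivB QT isLandau138_zero)
open B8Eq131Cubes (cube sqLo sqHi cube_anti)
open B8Eq131CubesAdmissible (cubeFam cubeFam_false_zero cubeFam_false_of_le)
open B8CubeMemberZd (cubeLamS)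
open B8Ineq159FlatCubeMemberPrinted (cubeLamBP)
open B8Eq191FlatStencils (covDerivFwd_flat_apply covDeriv_flat_apply QT_flat_apply)
open B8Eq191FlatLettersCubeMember (inBox_finite)
open B8FlatBondCalculusZd (not_inBox_of_hi_lt not_inBox_of_lt_lo)
open B8Ineq159FlatCubeMemberKernel (eq_zero_of_ineq159FlatData_eq_zero mem_cube_zero_iff)
open Literature.MathematicalPhysics.QuantumLattice (blockMap)

export B7Prop1Explicit (Site)

/-! ## §2 Flat linearity: the data and target quantities are `ℂ`-linear in the field; the Landau gauge of record is a subspace -/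

/-- The flat one-step linear average (122)∕(125) is `ℂ`-homogeneous. [cite: Balaban1985Averaging, (122) + (125) p.36] -/
theorem linQ_smul_complex (L : ℕ) (c : ℂ) (F : Site d → Fin d → ℂ) (q : Site d) (κ : Fin d) :
    linQ L (c • F) q κ = c • linQ L F q κ := by
  simp only [linQ, asum_seg_natCast, Pi.smul_apply, Finset.smul_sum]
  refine Finset.sum_congr rfl fun r _ => Finset.sum_congr rfl fun i _ => ?_
  rw [smul_comm]

/-- The flat one-step linear average is additive. [cite: Balaban1985Averaging, (122) + (125) p.36] -/
theorem linQ_add' (L : ℕ) (F G : Site d → Fin d → ℂ) (q : Site d) (κ : Fin d) :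
    linQ L (F + G) q κ = linQ L F q κ + linQ L G q κ := by
  have h := linQ_sub L (F + G) G q κ
  rw [add_sub_cancel_right] at h
  rw [h, sub_add_cancel]

/-- **The flat composite «Lʲη·Q_j(1)» (`B7Prop4Flat.linQIter`) is additive** («Q_j(U) … linear operators», [4] (3.15)).
[cite: Balaban1985Averaging, (127) p.37; Balaban1985BackgroundPropagators, (3.15) p.393] -/
theorem linQIter_add (L : ℕ) (F G : Site d → Fin d → ℂ) : ∀ j : ℕ, linQIter L (F + G) j = linQIter L F j + linQIter L G j
  | 0 => rfl
  | j + 1 => by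
    funext z κ
    rw [Pi.add_apply, Pi.add_apply, linQIter_succ, linQIter_succ, linQIter_succ, linQIter_add L F G j, linQ_add']

/-- **The flat composite «Lʲη·Q_j(1)» is `ℂ`-homogeneous.** [cite: Balaban1985Averaging, (127) p.37; Balaban1985BackgroundPropagators, (3.15) p.393] -/
theorem linQIter_smul (L : ℕ) (c : ℂ) (F : Site d → Fin d → ℂ) : ∀ j : ℕ, linQIter L (c • F) j = c • linQIter L F j
  | 0 => rfl
  | j + 1 => by
    funext z κ
    rw [Pi.smul_apply, Pi.smul_apply, linQIter_succ, linQIter_succ, linQIter_smul L c F j, linQ_smul_complex]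

/-- `iηA` is additive in `A`. [cite: Balaban1985RegularSpaces, (1.31) p.82] -/
theorem iEta_add (η : ℝ) (φ ψ : Site d → Fin d → ℂ) : iEta η (φ + ψ) = iEta η φ + iEta η ψ := by
  funext y κ; simp [B8Eq146AExpansion.iEta_def, mul_add]

/-- `iηA` is `ℂ`-homogeneous in `A`. [cite: Balaban1985RegularSpaces, (1.31) p.82] -/
theorem iEta_smul (η : ℝ) (c : ℂ) (φ : Site d → Fin d → ℂ) : iEta η (c • φ) = c • iEta η φ := by
  funext y κ; simp [B8Eq146AExpansion.iEta_def]; ring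

/-- The flat plaquette derivative (3.4) is additive. [cite: Balaban1985BackgroundPropagators, (3.4) p.391] -/
theorem plaqCovDeriv_flat_add (η : ℝ) (φ ψ : Site d → Fin d → ℂ) :
    plaqCovDeriv η (1 : Site d → Fin d → ℂˣ) (φ + ψ) =
      plaqCovDeriv η (1 : Site d → Fin d → ℂˣ) φ + plaqCovDeriv η (1 : Site d → Fin d → ℂˣ) ψ := by
  funext μ ν x
  simp only [Pi.add_apply, plaqCovDeriv_eq_covDerivFwd, covDerivFwd_flat_apply, smul_sub, smul_add]
  abel

/-- The flat plaquette derivative (3.4) is `ℂ`-homogeneous. [cite: Balaban1985BackgroundPropagators, (3.4) p.391] -/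
theorem plaqCovDeriv_flat_smul (η : ℝ) (c : ℂ) (φ : Site d → Fin d → ℂ) :
    plaqCovDeriv η (1 : Site d → Fin d → ℂˣ) (c • φ) = c • plaqCovDeriv η (1 : Site d → Fin d → ℂˣ) φ := by
  funext μ ν x
  simp only [Pi.smul_apply, plaqCovDeriv_eq_covDerivFwd, covDerivFwd_flat_apply, smul_eq_mul, Complex.real_smul]
  ring

/-- **The flat current `J = D^{η*}_1D^η_1` (1.55) is additive.** [cite: Balaban1985RegularSpaces, (1.55) p.86, (1.2) p.76] -/
theorem Jcur_flat_add (η : ℝ) (φ ψ : Site d → Fin d → ℂ) (τ : Fin d) (y : Site d) :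
    Jcur η (1 : Site d → Fin d → ℂˣ) (φ + ψ) τ y = Jcur η (1 : Site d → Fin d → ℂˣ) φ τ y + Jcur η (1 : Site d → Fin d → ℂˣ) ψ τ y := by
  rw [B8Eq155JBound.Jcur_def, B8Eq155JBound.Jcur_def, B8Eq155JBound.Jcur_def, plaqCovDeriv_flat_add, pdiv_add]

/-- **The flat current `J` is `ℂ`-homogeneous.** [cite: Balaban1985RegularSpaces, (1.55) p.86, (1.2) p.76] -/
theorem Jcur_flat_smul (η : ℝ) (c : ℂ) (φ : Site d → Fin d → ℂ) (τ : Fin d) (y : Site d) :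
    Jcur η (1 : Site d → Fin d → ℂˣ) (c • φ) τ y = c • Jcur η (1 : Site d → Fin d → ℂˣ) φ τ y := by
  rw [B8Eq155JBound.Jcur_def, B8Eq155JBound.Jcur_def, plaqCovDeriv_flat_smul, pdiv_smul]

/-- The flat divergence `D^{η*}_1` (1.38) is additive. [cite: Balaban1985RegularSpaces, (1.38) p.82, (1.1) p.76] -/
theorem covDivB_flat_add (η : ℝ) (φ ψ : Site d → Fin d → ℂ) :
    covDivB η (1 : Site d → Fin d → ℂˣ) (φ + ψ) = covDivB η (1 : Site d → Fin d → ℂˣ) φ + covDivB η (1 : Site d → Fin d → ℂˣ) ψ := by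
  funext x
  simp only [covDivB, Pi.add_apply, covDeriv_flat_apply, smul_sub, smul_add, Finset.sum_add_distrib, Finset.sum_sub_distrib]
  abel

/-- The flat divergence `D^{η*}_1` is `ℂ`-homogeneous. [cite: Balaban1985RegularSpaces, (1.38) p.82, (1.1) p.76] -/
theorem covDivB_flat_smul (η : ℝ) (c : ℂ) (φ : Site d → Fin d → ℂ) :
    covDivB η (1 : Site d → Fin d → ℂˣ) (c • φ) = c • covDivB η (1 : Site d → Fin d → ℂˣ) φ := by
  funext x
  simp only [covDivB, Pi.smul_apply, covDeriv_flat_apply, smul_eq_mul, Complex.real_smul, Finset.mul_sum]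
  refine Finset.sum_congr rfl fun μ _ => ?_
  ring

/-- The flat gradient is additive (as a bond field). [cite: Balaban1985RegularSpaces, (1.1) p.76] -/
theorem grad_flat_add (η : ℝ) (f g : Site d → ℂ) :
    (fun z μ => covDerivFwd η (1 : Site d → Fin d → ℂˣ) μ (f + g) z) =
      (fun z μ => covDerivFwd η (1 : Site d → Fin d → ℂˣ) μ f z) + (fun z μ => covDerivFwd η (1 : Site d → Fin d → ℂˣ) μ g z) := by
  funext z μ
  simp only [Pi.add_apply, covDerivFwd_flat_apply, smul_sub, smul_add]
  abel

/-- The flat gradient is `ℂ`-homogeneous. [cite: Balaban1985RegularSpaces, (1.1) p.76] -/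
theorem grad_flat_smul (η : ℝ) (c : ℂ) (f : Site d → ℂ) :
    (fun z μ => covDerivFwd η (1 : Site d → Fin d → ℂˣ) μ (c • f) z) =
      c • (fun z μ => covDerivFwd η (1 : Site d → Fin d → ℂˣ) μ f z) := by
  funext z μ
  simp only [Pi.smul_apply, covDerivFwd_flat_apply, smul_eq_mul, Complex.real_smul]
  ring

/-- **The flat Laplacian (3.23) is additive.** [cite: Balaban1985BackgroundPropagators, (3.23) p.394] -/
theorem covLap_flat_add (η : ℝ) (f g : Site d → ℂ) :
    covLap η (1 : Site d → Fin d → ℂˣ) (f + g) = covLap η (1 : Site d → Fin d → ℂˣ) f + covLap η (1 : Site d → Fin d → ℂˣ) g := by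
  funext x
  show covDivB η _ (fun z μ => covDerivFwd η (1 : Site d → Fin d → ℂˣ) μ (f + g) z) x = _
  rw [grad_flat_add, covDivB_flat_add]; rfl

/-- **The flat Laplacian is `ℂ`-homogeneous.** [cite: Balaban1985BackgroundPropagators, (3.23) p.394] -/
theorem covLap_flat_smul (η : ℝ) (c : ℂ) (f : Site d → ℂ) :
    covLap η (1 : Site d → Fin d → ℂˣ) (c • f) = c • covLap η (1 : Site d → Fin d → ℂˣ) f := by
  funext x
  show covDivB η _ (fun z μ => covDerivFwd η (1 : Site d → Fin d → ℂˣ) μ (c • f) z) x = _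
  rw [grad_flat_smul, covDivB_flat_smul]; rfl

/-- Indicators commute with scalars (bookkeeping). [folklore] -/
private theorem indicator_const_smul' (s : Set (Site d)) (c : ℂ) (f : Site d → ℂ) :
    s.indicator (c • f) = c • s.indicator f := by
  funext y
  by_cases hy : y ∈ s <;> simp [hy]

/-- The flat transpose `Q′(1)ᵀ` on multipliers is additive. [cite: Balaban1985BackgroundPropagators, (3.24) p.394, (3.19) p.393] -/
theorem QT_flat_add (L m : ℕ) (Λs : ℕ → Set (Site d)) (μ₁ μ₂ : ℕ → Site d → ℂ) (x : Site d) :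
    QT L m Λs (1 : Site d → Fin d → ℂˣ) (μ₁ + μ₂) x = QT L m Λs (1 : Site d → Fin d → ℂˣ) μ₁ x + QT L m Λs (1 : Site d → Fin d → ℂˣ) μ₂ x := by
  rw [QT_flat_apply, QT_flat_apply, QT_flat_apply, ← Finset.sum_add_distrib]
  refine Finset.sum_congr rfl fun j _ => ?_
  rw [← smul_add, Pi.add_apply, Set.indicator_add', Pi.add_apply]

/-- The flat transpose `Q′(1)ᵀ` on multipliers is `ℂ`-homogeneous. [cite: Balaban1985BackgroundPropagators, (3.24) p.394, (3.19) p.393] -/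
theorem QT_flat_smul (L m : ℕ) (Λs : ℕ → Set (Site d)) (c : ℂ) (μ : ℕ → Site d → ℂ) (x : Site d) :
    QT L m Λs (1 : Site d → Fin d → ℂˣ) (c • μ) x = c • QT L m Λs (1 : Site d → Fin d → ℂˣ) μ x := by
  rw [QT_flat_apply, QT_flat_apply, Finset.smul_sum]
  refine Finset.sum_congr rfl fun j _ => ?_
  rw [smul_comm, Pi.smul_apply, indicator_const_smul', Pi.smul_apply]

/-- ★ **THE FLAT LANDAU GAUGE OF RECORD (1.38) IS CLOSED UNDER ADDITION** (multiplier form: add the multipliers).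
[cite: Balaban1985RegularSpaces, (1.38) p.82; Balaban1985BackgroundPropagators, (3.24)–(3.25) p.394] -/
theorem isLandau138_flat_add {L m : ℕ} {η : ℝ} {Ω₀ : Set (Site d)} {Λs : ℕ → Set (Site d)} {φ ψ : Site d → Fin d → ℂ}
    (hφ : IsLandau138 L m η Ω₀ Λs (1 : Site d → Fin d → ℂˣ) φ) (hψ : IsLandau138 L m η Ω₀ Λs (1 : Site d → Fin d → ℂˣ) ψ) :
    IsLandau138 L m η Ω₀ Λs (1 : Site d → Fin d → ℂˣ) (φ + ψ) := by
  obtain ⟨μ₁, h₁⟩ := hφ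
  obtain ⟨μ₂, h₂⟩ := hψ
  refine ⟨μ₁ + μ₂, fun x hx => ?_⟩
  rw [covDivB_flat_add, Set.indicator_add', covLap_flat_add, Pi.add_apply, QT_flat_add, h₁ x hx, h₂ x hx]

/-- ★ **THE FLAT LANDAU GAUGE OF RECORD (1.38) IS CLOSED UNDER SCALARS.** [cite: Balaban1985RegularSpaces, (1.38) p.82; Balaban1985BackgroundPropagators, (3.24)–(3.25) p.394] -/
theorem isLandau138_flat_smul {L m : ℕ} {η : ℝ} {Ω₀ : Set (Site d)} {Λs : ℕ → Set (Site d)} {φ : Site d → Fin d → ℂ}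
    (c : ℂ) (hφ : IsLandau138 L m η Ω₀ Λs (1 : Site d → Fin d → ℂˣ) φ) :
    IsLandau138 L m η Ω₀ Λs (1 : Site d → Fin d → ℂˣ) (c • φ) := by
  obtain ⟨μ, h⟩ := hφ
  refine ⟨c • μ, fun x hx => ?_⟩
  rw [covDivB_flat_smul, indicator_const_smul', covLap_flat_smul, Pi.smul_apply, QT_flat_smul, h x hx]


/-! ## §3 Finiteness of the bond sets of one cube member -/

/-- A bond touching the box `[lo, hi]` starts in the box `[lo − 1, hi]`. [cite: Balaban1985RegularSpaces, p.77 (bond convention)] -/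
theorem inBox_pred_of_bondTouches {lo hi : Site d} {y : Site d} {τ : Fin d} (h : BondTouches {x | InBox lo hi x} y τ) :
    InBox (lo - 1) hi y := by
  intro i
  rcases h with h | h
  · have := h i; simp only [Pi.sub_apply, Pi.one_apply]; omega
  · have := h i
    rw [add_e_apply] at this
    simp only [Pi.sub_apply, Pi.one_apply]
    split_ifs at this <;> omega

/-- A bond that is a side of a plaquette touching the box `[lo, hi]` starts in the box `[lo − 2, hi + 1]`. [cite: Balaban1985RegularSpaces, p.77 (plaquette convention)] -/
theorem inBox_widen_of_sideTouches {lo hi : Site d} {y : Site d} {τ : Fin d} (h : SideTouches {x | InBox lo hi x} y τ) :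
    InBox (lo - 2) (hi + 1) y := by
  obtain ⟨z, κ, ν, -, hp, hs⟩ := h
  -- a corner of the plaquette lies in the box, so `z ∈ [lo − 2, hi]`
  have hz : ∀ i, lo i - 2 ≤ z i ∧ z i ≤ hi i := by
    intro i
    rcases hp with h | h | h | h
    · have := h i; omega
    · have := h i; rw [add_e_apply] at this; split_ifs at this <;> omega
    · have := h i; rw [add_e_apply] at this; split_ifs at this <;> omega
    · have := h i; rw [add_e_apply, add_e_apply] at this; split_ifs at this <;> omega
  intro i
  have hzi := hz i
  simp only [Pi.sub_apply, Pi.add_apply, Pi.one_apply]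
  rcases hs with ⟨rfl, -⟩ | ⟨rfl, -⟩ | ⟨rfl, -⟩ | ⟨rfl, -⟩
  · simp only [Pi.ofNat_apply]; omega
  · rw [add_e_apply]; simp only [Pi.ofNat_apply]; split_ifs <;> omega
  · rw [add_e_apply]; simp only [Pi.ofNat_apply]; split_ifs <;> omega
  · simp only [Pi.ofNat_apply]; omega

/-- **The bonds touching `□₀` form a finite set.** [cite: Balaban1985RegularSpaces, (1.131) p.99, p.77] -/
theorem bondTouches_cube_zero_finite (L : ℕ) (a : Site d) (M ρ k : ℕ) :
    {b : Site d × Fin d | BondTouches (cube L a M ρ k 0) b.1 b.2}.Finite := by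
  refine ((inBox_finite (sqLo L a ρ k 0 - 1) (sqHi L a M ρ k 0)).prod (Set.finite_univ (α := Fin d))).subset ?_
  rintro ⟨y, τ⟩ h
  exact ⟨inBox_pred_of_bondTouches h, Set.mem_univ _⟩

/-- **The bonds of print's class at all levels `j ≤ m` form a finite set.** [cite: Balaban1985RegularSpaces, (1.31) p.82, (1.131) p.99; Balaban1984PropagatorsII, (2.3) p.224] -/
theorem cubeLamBP_pairs_finite (L : ℕ) (a : Site d) (M ρ k m : ℕ) :
    {p : ℕ × (Site d × Fin d) | p.1 ≤ m ∧ p.2 ∈ cubeLamBP L a M ρ k m p.1}.Finite := by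
  have hfin : ∀ j : ℕ, ({j} ×ˢ ({x : Site d | InBox (sqLo L a ρ k j - 1) (sqHi L a M ρ k j) x} ×ˢ (Set.univ : Set (Fin d)))).Finite :=
    fun j => (Set.finite_singleton j).prod ((inBox_finite _ _).prod Set.finite_univ)
  refine ((Finset.range (m + 1)).finite_toSet.biUnion fun j _ => hfin j).subset ?_
  rintro ⟨j, y, τ⟩ ⟨hj, hc⟩
  simp only [Set.mem_iUnion, Finset.coe_range, Set.mem_Iio, Set.mem_prod, Set.mem_singleton_iff, Set.mem_setOf_eq,
    Set.mem_univ, and_true, exists_prop]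
  refine ⟨j, Nat.lt_succ_of_le hj, rfl, ?_⟩
  obtain ⟨-, hends, -⟩ := hc
  exact inBox_pred_of_bondTouches (lo := sqLo L a ρ k j) (hi := sqHi L a M ρ k j) hends

/-- **The bonds side-touching some `□_j`, `j ≤ m ≤ k`, form a finite set.** [cite: Balaban1985RegularSpaces, (1.62) p.87, p.77, (1.131) p.99] -/
theorem sideTouches_pairs_finite (L : ℕ) (a : Site d) (M ρ : ℕ) {k m : ℕ} (hmk : m ≤ k) :
    {q : ℕ × (Site d × Fin d) | q.1 ≤ m ∧ SideTouches (cubeFam false L a M ρ k q.1) q.2.1 q.2.2}.Finite := by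
  refine (((Finset.range (m + 1)).finite_toSet).prod
    ((inBox_finite (sqLo L a ρ k 0 - 2) (sqHi L a M ρ k 0 + 1)).prod (Set.finite_univ (α := Fin d)))).subset ?_
  rintro ⟨j, y, τ⟩ ⟨hj, hs⟩
  simp only [Set.mem_prod, Finset.coe_range, Set.mem_Iio, Set.mem_setOf_eq, Set.mem_univ, and_true]
  refine ⟨Nat.lt_succ_of_le hj, ?_⟩
  have hsub : cubeFam false L a M ρ k j ⊆ {x | InBox (sqLo L a ρ k 0) (sqHi L a M ρ k 0) x} := by
    rw [cubeFam_false_of_le L a M ρ (hj.trans hmk)]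
    exact cube_anti (Nat.zero_le j) (hj.trans hmk)
  exact inBox_widen_of_sideTouches (B8Eq140Level.sideTouches_mono hsub hs)

/-! ## §4 The per-cube constant: the body of `Ineq159FlatCubeMemberPrinted` holds at every fixed member with SOME `B₀` -/

/-- ★★★ **(1.59) AT `U₀ = 1` ON THE CUBE MEMBER, PER-CUBE CONSTANT** — the A6 inhabitant of the repaired flat target.  For `d ≥ 2`, `L ≥ 1`,
`η > 0`, every cube datum `(a, M, ρ, k)` of (1.131) and every truncation `1 ≤ m ≤ k` THERE IS `B₀ > 0` (depending on the member) such that the body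
of dag-n05-c's `B8Ineq159FlatCubeMemberPrinted.Ineq159FlatCubeMemberPrinted` holds: for every bond function `φ` in the flat Landau gauge of record
with the support clause, and every `N ≥ 0` bounding (i) `(Lʲη)³|J(φ)|` on the bonds of `□_j`, (ii) the un-normalised flat averages on EVERY bond of
print's class `cubeLamBP … m j`, (iii) `η|φ|` off the bonds of `□₀`, one has on every bond side-touching `□_j`: `(Lʲη)|φ| ≤ B₀N`,
`(Lʲη)²|D^η_{1,ν}φ_τ| ≤ B₀N`, `(Lʲη)³|Δ^η_1φ_τ| ≤ B₀N`.  PROOF: the admissible fields form a `ℂ`-subspace (§2), the data (i)–(iii) at `N = 0`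
force `φ = 0` (`B8Ineq159FlatCubeMemberKernel.eq_zero_of_ineq159FlatData_eq_zero`), finitely many data and target functionals are in play (§3),
so §1 gives the constant.  HONEST SCOPE: `B₀` is NOT print's uniform `B₀(d, L)` (that is [4] Thm 3.3's estimate, the transplant T2–T4 — open);
this is the satisfiability witness of the repaired hypotheses at every member with `k ≥ 1`, `m ≥ 1`.
[cite: Balaban1985RegularSpaces, (1.59) p.86, (1.62) p.87, (1.31) p.82, (1.38) p.82, (1.131) p.99; Balaban1984PropagatorsII, (2.11) p.225, (2.3) p.224; Balaban1985BackgroundPropagators, Thm 3.3 p.399, (3.25) p.394] -/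
theorem exists_B0_ineq159Flat_perCube (hd2 : 2 ≤ d) {L : ℕ} (hL : 1 ≤ L) {η : ℝ} (hη : 0 < η) (a : Site d) (M ρ : ℕ)
    {k m : ℕ} (hm1 : 1 ≤ m) (hmk : m ≤ k) :
    ∃ B₀ : ℝ, 0 < B₀ ∧ ∀ φ : Site d → Fin d → ℂ,
      IsLandau138 L m η (cubeFam false L a M ρ k 0) (cubeLamS L a M ρ k m) (1 : Site d → Fin d → ℂˣ) φ →
      (∀ (y : Site d) (τ : Fin d), (∀ j, j ≤ m → ¬ SideTouches (cubeFam false L a M ρ k j) y τ) → φ y τ = 0) →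
      ∀ N : ℝ, 0 ≤ N →
        (∀ j, j ≤ m → ∀ (y : Site d) (τ : Fin d), BondTouches (cubeFam false L a M ρ k j) y τ →
            ((L : ℝ) ^ j * η) ^ 3 * ‖Jcur η (1 : Site d → Fin d → ℂˣ) φ τ y‖ ≤ N) →
        (∀ j, j ≤ m → ∀ c ∈ cubeLamBP L a M ρ k m j,
            ‖linCovIter L (1 : Site d → Fin d → ℂˣ) (iEta η φ) j c.1 c.2‖ ≤ N) →
        (∀ (y : Site d) (τ : Fin d), ¬ BondTouches (cubeFam false L a M ρ k 0) y τ → η * ‖φ y τ‖ ≤ N) →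
        ∀ j, j ≤ m → ∀ (y : Site d) (τ : Fin d), SideTouches (cubeFam false L a M ρ k j) y τ →
          ((L : ℝ) ^ j * η) * ‖φ y τ‖ ≤ B₀ * N ∧
          (∀ ν : Fin d, ((L : ℝ) ^ j * η) ^ 2 *
            ‖covDerivFwd η (1 : Site d → Fin d → ℂˣ) ν (fun z => φ z τ) y‖ ≤ B₀ * N) ∧
          ((L : ℝ) ^ j * η) ^ 3 * ‖covLap η (1 : Site d → Fin d → ℂˣ) (fun z => φ z τ) y‖ ≤ B₀ * N := by
  classical
  have hΩ0 : cubeFam false L a M ρ k 0 = cube L a M ρ k 0 := cubeFam_false_zero L a M ρ k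
  -- the finite bond sets of the member
  set TB := (bondTouches_cube_zero_finite L a M ρ k).toFinset with hTB
  set TC := (cubeLamBP_pairs_finite L a M ρ k m).toFinset with hTC
  set TS := (sideTouches_pairs_finite L a M ρ hmk).toFinset with hTS
  have hS3fin : {b : Site d × Fin d | (∃ j, j ≤ m ∧ SideTouches (cubeFam false L a M ρ k j) b.1 b.2) ∧
      ¬ BondTouches (cubeFam false L a M ρ k 0) b.1 b.2}.Finite := by
    refine ((sideTouches_pairs_finite L a M ρ hmk).image Prod.snd).subset ?_
    rintro ⟨y, τ⟩ ⟨⟨j, hj, hs⟩, -⟩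
    exact ⟨(j, (y, τ)), ⟨hj, hs⟩, rfl⟩
  set T3 := hS3fin.toFinset with hT3
  have memTB : ∀ {y τ}, BondTouches (cubeFam false L a M ρ k 0) y τ → (y, τ) ∈ TB := fun h => by
    rw [hTB, Set.Finite.mem_toFinset]; rw [hΩ0] at h; exact h
  have memTC : ∀ {j c}, j ≤ m → c ∈ cubeLamBP L a M ρ k m j → (j, c) ∈ TC := fun hj hc => by
    rw [hTC, Set.Finite.mem_toFinset]; exact ⟨hj, hc⟩
  have memTS : ∀ {j y τ}, j ≤ m → SideTouches (cubeFam false L a M ρ k j) y τ → (j, (y, τ)) ∈ TS := fun hj hs => by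
    rw [hTS, Set.Finite.mem_toFinset]; exact ⟨hj, hs⟩
  have memT3 : ∀ {y τ}, (∃ j, j ≤ m ∧ SideTouches (cubeFam false L a M ρ k j) y τ) →
      ¬ BondTouches (cubeFam false L a M ρ k 0) y τ → (y, τ) ∈ T3 := fun h1 h2 => by
    rw [hT3, Set.Finite.mem_toFinset]; exact ⟨h1, h2⟩
  -- boundedness of a field with the support clause
  have hbdd : ∀ φ : Site d → Fin d → ℂ,
      (∀ (y : Site d) (τ : Fin d), (∀ j, j ≤ m → ¬ SideTouches (cubeFam false L a M ρ k j) y τ) → φ y τ = 0) →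
      ∃ b : ℝ, 0 ≤ b ∧ ∀ y τ, ‖iEta η φ y τ‖ ≤ b := by
    intro φ hs
    refine ⟨∑ q ∈ TS, ‖iEta η φ q.2.1 q.2.2‖, Finset.sum_nonneg fun _ _ => norm_nonneg _, fun y τ => ?_⟩
    by_cases h : ∃ j, j ≤ m ∧ SideTouches (cubeFam false L a M ρ k j) y τ
    · obtain ⟨j, hj, hst⟩ := h
      exact Finset.single_le_sum (f := fun q : ℕ × (Site d × Fin d) => ‖iEta η φ q.2.1 q.2.2‖)
        (fun _ _ => norm_nonneg _) (memTS hj hst)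
    · push Not at h
      have h0 : φ y τ = 0 := hs y τ fun j hj hst => h j hj hst
      simp only [B8Eq146AExpansion.iEta_def, h0, smul_zero, norm_zero]
      exact Finset.sum_nonneg fun _ _ => norm_nonneg _
  -- the subspace of admissible fields
  let V : Submodule ℂ (Site d → Fin d → ℂ) :=
    { carrier := {φ | IsLandau138 L m η (cubeFam false L a M ρ k 0) (cubeLamS L a M ρ k m) (1 : Site d → Fin d → ℂˣ) φ ∧
        ∀ (y : Site d) (τ : Fin d), (∀ j, j ≤ m → ¬ SideTouches (cubeFam false L a M ρ k j) y τ) → φ y τ = 0}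
      add_mem' := by
        rintro φ ψ ⟨h1, h2⟩ ⟨h3, h4⟩
        exact ⟨isLandau138_flat_add h1 h3, fun y τ h => by rw [Pi.add_apply, Pi.add_apply, h2 y τ h, h4 y τ h, add_zero]⟩
      zero_mem' := ⟨isLandau138_zero η L (1 : Site d → Fin d → ℂˣ) m _ _, fun _ _ _ => rfl⟩
      smul_mem' := by
        rintro c φ ⟨h1, h2⟩
        exact ⟨isLandau138_flat_smul c h1, fun y τ h => by rw [Pi.smul_apply, Pi.smul_apply, h2 y τ h, smul_zero]⟩ }
  have hVmem : ∀ {φ}, φ ∈ V ↔ (IsLandau138 L m η (cubeFam false L a M ρ k 0) (cubeLamS L a M ρ k m) (1 : Site d → Fin d → ℂˣ) φ ∧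
      ∀ (y : Site d) (τ : Fin d), (∀ j, j ≤ m → ¬ SideTouches (cubeFam false L a M ρ k j) y τ) → φ y τ = 0) := Iff.rfl
  -- the linear functionals
  let ev : Site d → Fin d → (Site d → Fin d → ℂ) →ₗ[ℂ] ℂ := fun y τ =>
    { toFun := fun φ => φ y τ, map_add' := fun _ _ => rfl, map_smul' := fun _ _ => rfl }
  let Jl : Site d → Fin d → (Site d → Fin d → ℂ) →ₗ[ℂ] ℂ := fun y τ =>
    { toFun := fun φ => Jcur η (1 : Site d → Fin d → ℂˣ) φ τ y
      map_add' := fun φ ψ => Jcur_flat_add η φ ψ τ y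
      map_smul' := fun c φ => Jcur_flat_smul η c φ τ y }
  let Ql : ℕ → Site d → Fin d → (Site d → Fin d → ℂ) →ₗ[ℂ] ℂ := fun j z κ =>
    { toFun := fun φ => linQIter L (iEta η φ) j z κ
      map_add' := fun φ ψ => by
        show linQIter L (iEta η (φ + ψ)) j z κ = _
        rw [iEta_add, linQIter_add]; rfl
      map_smul' := fun c φ => by
        show linQIter L (iEta η (c • φ)) j z κ = _
        rw [iEta_smul, linQIter_smul]; rfl }
  let Dl : Fin d → Site d → Fin d → (Site d → Fin d → ℂ) →ₗ[ℂ] ℂ := fun ν y τ =>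
    { toFun := fun φ => covDerivFwd η (1 : Site d → Fin d → ℂˣ) ν (fun z => φ z τ) y
      map_add' := fun φ ψ => by
        simp only [covDerivFwd_flat_apply, Pi.add_apply, smul_add, smul_sub]
        abel
      map_smul' := fun c φ => by
        simp only [covDerivFwd_flat_apply, Pi.smul_apply, smul_eq_mul, Complex.real_smul, RingHom.id_apply]
        ring }
  let Ll : Site d → Fin d → (Site d → Fin d → ℂ) →ₗ[ℂ] ℂ := fun y τ =>
    { toFun := fun φ => covLap η (1 : Site d → Fin d → ℂˣ) (fun z => φ z τ) y
      map_add' := fun φ ψ => by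
        exact congrFun (covLap_flat_add η (fun z => φ z τ) (fun z => ψ z τ)) y
      map_smul' := fun c φ => by
        exact congrFun (covLap_flat_smul η c (fun z => φ z τ)) y }
  -- data and target families
  let f : (↥TB ⊕ (↥TC ⊕ ↥T3)) → (Site d → Fin d → ℂ) →ₗ[ℂ] ℂ :=
    Sum.elim (fun b => ((η : ℂ) ^ 3) • Jl b.1.1 b.1.2)
      (Sum.elim (fun p => Ql p.1.1 p.1.2.1 p.1.2.2) (fun b => (η : ℂ) • ev b.1.1 b.1.2))
  let g : (↥TS ⊕ ((↥TS × Fin d) ⊕ ↥TS)) → (Site d → Fin d → ℂ) →ₗ[ℂ] ℂ :=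
    Sum.elim (fun q => (((L : ℝ) ^ q.1.1 * η : ℝ) : ℂ) • ev q.1.2.1 q.1.2.2)
      (Sum.elim (fun qν => ((((L : ℝ) ^ qν.1.1.1 * η) ^ 2 : ℝ) : ℂ) • Dl qν.2 qν.1.1.2.1 qν.1.1.2.2)
        (fun q => ((((L : ℝ) ^ q.1.1 * η) ^ 3 : ℝ) : ℂ) • Ll q.1.2.1 q.1.2.2))
  have hηC : (η : ℂ) ≠ 0 := Complex.ofReal_ne_zero.2 hη.ne'
  -- joint kernel of the data is trivial on `V`: the kernel theorem
  have hinj : ∀ φ ∈ V, (∀ x, f x φ = 0) → φ = 0 := by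
    intro φ hφV hf0
    obtain ⟨hLan, hs⟩ := (hVmem).1 hφV
    obtain ⟨b, hb0, hb⟩ := hbdd φ hs
    refine eq_zero_of_ineq159FlatData_eq_zero hd2 hL hη a M ρ hm1 hmk hLan ?_ ?_ ?_
    · intro y τ hbt
      by_cases h : ∃ j, j ≤ m ∧ SideTouches (cubeFam false L a M ρ k j) y τ
      · have := hf0 (Sum.inr (Sum.inr ⟨(y, τ), memT3 h hbt⟩))
        simp only [f, Sum.elim_inr, LinearMap.smul_apply, smul_eq_zero] at this
        rcases this with h0 | h0
        · exact absurd h0 hηC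
        · exact h0
      · push Not at h
        exact hs y τ fun j hj hst => h j hj hst
    · intro y τ hbt
      have := hf0 (Sum.inl ⟨(y, τ), memTB hbt⟩)
      simp only [f, Sum.elim_inl, LinearMap.smul_apply, smul_eq_zero] at this
      rcases this with h0 | h0
      · exact absurd h0 (pow_ne_zero 3 hηC)
      · exact h0
    · intro j hj c hc
      have := hf0 (Sum.inr (Sum.inl ⟨(j, c), memTC hj hc⟩))
      simp only [f, Sum.elim_inr, Sum.elim_inl] at this
      rw [linCovIter_one_left L hL (iEta η φ) hb0 hb j]
      exact this
  obtain ⟨C, hC0, hC⟩ := exists_bound_of_forall_eq_zero V f g hinj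
  refine ⟨max C 1, by positivity, fun φ hLan hs N hN h1 h2 h3 j hj y τ hst => ?_⟩
  have hφV : φ ∈ V := (hVmem).2 ⟨hLan, hs⟩
  obtain ⟨b, hb0, hb⟩ := hbdd φ hs
  -- the data bounds
  have hfa : ∀ x, ‖f x φ‖ ≤ N := by
    rintro (bb | pp | bb)
    · obtain ⟨⟨y', τ'⟩, hmem⟩ := bb
      have hbt : BondTouches (cubeFam false L a M ρ k 0) y' τ' := by
        rw [hTB, Set.Finite.mem_toFinset] at hmem; rw [hΩ0]; exact hmem
      have := h1 0 (Nat.zero_le m) y' τ' hbt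
      rw [pow_zero, one_mul] at this
      simp only [f, Sum.elim_inl, LinearMap.smul_apply, norm_smul, norm_pow, Complex.norm_real, Real.norm_of_nonneg hη.le]
      exact this
    · obtain ⟨⟨j', c⟩, hmem⟩ := pp
      have hmem' : j' ≤ m ∧ c ∈ cubeLamBP L a M ρ k m j' := by rw [hTC, Set.Finite.mem_toFinset] at hmem; exact hmem
      have := h2 j' hmem'.1 c hmem'.2
      rw [linCovIter_one_left L hL (iEta η φ) hb0 hb j'] at this
      exact this
    · obtain ⟨⟨y', τ'⟩, hmem⟩ := bb
      have hmem' := hmem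
      rw [hT3, Set.Finite.mem_toFinset] at hmem'
      have := h3 y' τ' hmem'.2
      simp only [f, Sum.elim_inr, LinearMap.smul_apply, norm_smul, Complex.norm_real, Real.norm_of_nonneg hη.le]
      exact this
  have key := hC φ hφV N hN hfa
  have hCle : C * N ≤ max C 1 * N := mul_le_mul_of_nonneg_right (le_max_left _ _) hN
  have hw : 0 ≤ (L : ℝ) ^ j * η := by positivity
  have hq : (j, (y, τ)) ∈ TS := memTS hj hst
  refine ⟨?_, fun ν => ?_, ?_⟩
  · have := key (Sum.inl ⟨(j, (y, τ)), hq⟩)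
    simp only [g, ev, Sum.elim_inl, LinearMap.smul_apply, LinearMap.coe_mk, AddHom.coe_mk, norm_smul, Complex.norm_real,
      Real.norm_of_nonneg hw] at this
    exact this.trans hCle
  · have := key (Sum.inr (Sum.inl (⟨(j, (y, τ)), hq⟩, ν)))
    simp only [g, Dl, Sum.elim_inr, Sum.elim_inl, LinearMap.smul_apply, LinearMap.coe_mk, AddHom.coe_mk, norm_smul,
      Complex.norm_real, Real.norm_of_nonneg (pow_nonneg hw 2)] at this
    exact this.trans hCle
  · have := key (Sum.inr (Sum.inr ⟨(j, (y, τ)), hq⟩))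
    simp only [g, Ll, Sum.elim_inr, LinearMap.smul_apply, LinearMap.coe_mk, AddHom.coe_mk, norm_smul, Complex.norm_real,
      Real.norm_of_nonneg (pow_nonneg hw 3)] at this
    exact this.trans hCle

#print axioms exists_B0_ineq159Flat_perCube

#print axioms exists_bound_of_forall_eq_zero

end Literature.MathematicalPhysics.QuantumFieldTheory.Balaban1983to89.B8Ineq159FlatCubeMemberPerCube

end
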